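import Summits.QuantumFields.BalabanUV.Beta.RootedAveragingInversion

/-!
# `BalabanUV.Beta.RootedMixedChartReflection` — binder row D1, AVG-LETTERS chain (an1's plan AN1-28B; twin of an3-g33's M2b
# `RootedJetReflection` for node 12b's MIXED chart `U_f = Z_f·(1 + σB_f)`, the chart of `MjetAt` ∕ `tTab` ∕ `mixFFAt`):
# mixed left charts with a general (Tau-valued) background letter, the inverse pair `Zf·Zb = 1`, the REFLECTED CHART DATA, and the
# TRANSVERSE (`μ ≠ α`) reflection law of the rooted mixed averaging `PhiMAt`

HONEST FRAMING (cell charter, verbatim): «discharging BetaPertH makes Balaban's UV stability UNCONDITIONAL — a real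
constructive-QFT result; it is NOT the continuum limit and NOT the Clay problem.»
HONEST DEPENDENCY: continuum YM on T⁴ ⇐ BetaPertH ∧ nine spine estimates (0/9 proved); BetaPertH ⇐ (D1) ∧ (D4) ∧ CAP+tail;
G-an2-4 gates asym, D1 and NE2/3/4.
DERIVED cell leaf ([folklore] ring algebra in node 12's `Tau 𝔸` ∕ `Rho 𝔸` over node 12b's `Gm`∕`Gmb`∕`PhiMAt`∕`MjetAt` and an1's M1 `reflPair`∕
`PhiGAt_sref_of_ne` BY NAME).  No statement of Bałaban's papers, no `[cite:]`, no `Prop` fact; the data definitions `GmL`∕`GmbL`∕`PhiMLAt`∕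
`MjetLAt`∕`BR` are [our object]s; nothing about the tables `mixFFAt`∕`vh₂SAt` or the letters (hM2)∕(hBe) is proved; 0∕4 binders of the wall
touched.  NOT D1, NOT BetaPertH, NOT continuum, NOT Clay.

## What is here (reflected axis `α`, partner bond map `bref α`; `L` odd and centred root `ctr d L` where M1 needs it; `(2 : 𝕜) ≠ 0` where the
## inverse pair `Zf·Zb = 1` is needed)
* §1 `GmL Z b κ x := dmk (Z κ x) 0 * dmk 1 (b κ x)` (= `(Z, Z b)`), `GmbL Z̄ b := (Z̄, −b Z̄)`; bridges `Gm_eq_GmL : Gm 𝕜 W V B = GmL (Zf 𝕜 W V) (upF B)`,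
  `Gmb_eq_GmbL`; the rooted families `PhiMLAt`, `MσLAt` (the `Tau`-valued `σ`-jet), `MjetLAt = c11 ∘ MσLAt` with `PhiMAt_eq_PhiMLAt`, `MjetAt_eq_MjetLAt`; `Zf_mul_Zb`, `Zb_mul_Zf` (node 12b
  states but does not prove them; the `τ₁τ₂`-component is `(2·2⁻¹ − 1)(WV + VW)`); the reflected background letter
  `BR α W V B κ x := if κ = α then −(Zf·ιB·Zb)(κ, bref α κ x) else ι (B κ (bref α κ x))` (Tau-valued: ON the axis the sign-flipped letter is
  Ad-rotated by the fluctuation exponential at the partner bond); **`reflPair_Gm_Gmb`**: `reflPair α (Gm 𝕜 W V B) (Gmb 𝕜 W V B) = GmL Z♯ B♯` with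
  `Z♯ = reflPair α (Zf 𝕜 W V) (Zb 𝕜 W V)` (the fluctuation exponential reflects AS A LETTER PAIR), **`reflPair_Gmb_Gm`**.
* §2 **`PhiMAt_sref_of_ne`** (`μ ≠ α`): `PhiMAt (ctr d L) W V B L μ (sref α y) = PhiMLAt (ctr d L) Z♯ Z̄♯ B♯ L μ y` (M1 `PhiGAt_sref_of_ne`).
* §3 `Gm_mul_Gmb`∕`Gmb_mul_Gm` (inverse pair, char ≠ 2), `augR_Gm`∕`augR_Gmb`, and the LONGITUDINAL law **`PhiMLAt_reflPair_self_eq_invT`** (`μ = α`):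
  `PhiMLAt (ctr d L) Z♯ Z̄♯ B♯ L α y = invT (PhiMAt (ctr d L) W V B L α (bref α α y))` — an3-g33's 33C `RootedAveragingInversion` at node 12's
  instance (`Rho 𝔸`, `augR`, `nil4_augR`) — and its product form `PhiMLAt_reflPair_self_mul`.  The jet-level (`MjetAt`) longitudinal law is M4's.
Provenance: β sub-cell, D1 formalisation swarm, unit b2b-balaban-beta-d1-formalise-leaf-05 gen 7, 2026-08-20 (v1); no existing file touched.
-/

namespace Summit.QuantumFields.BalabanUV.Beta.RootedMixedChartReflection

open Finset
open scoped BigOperators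
open Literature.MathematicalPhysics.QuantumFieldTheory.Balaban1983to89
open Literature.MathematicalPhysics.QuantumFieldTheory.Balaban1983to89.Beta
open AffineAveraging (Form1)
open AveragingContoursRooted (ctr)
open Literature.MathematicalPhysics.QuantumFieldTheory.Balaban1983to89.Beta.AveragingThirdJet
open Literature.MathematicalPhysics.QuantumFieldTheory.Balaban1983to89.Beta.AveragingThirdJet.Tau
open AveragingMixedJetTables (PhiGAt Zf Zb Gm Gmb PhiMAt MjetAt)
open ResolventReflection (sref bref bref_of_ne bref_self)
open Summit.QuantumFields.BalabanUV.Beta.RootedHolonomyReflection (R1g R1g_of_ne)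
open Summit.QuantumFields.BalabanUV.Beta.RootedHolonomyReflectionHol (reflPair reflPair_of_ne reflPair_self PhiGAt_sref_of_ne)
open Summit.QuantumFields.BalabanUV.Beta.TruncatedNil4Calculus (nil4_augR)
open Summit.QuantumFields.BalabanUV.Beta.RootedAveragingInversion (PhiGAt_reflPair_self_eq_invT PhiGAt_reflPair_self_mul mul_PhiGAt_reflPair_self)

variable (𝕜 : Type*) [Field 𝕜] {d : ℕ} {𝔸 : Type*} [Ring 𝔸] [Algebra 𝕜 𝔸]

/-! ## §1 The mixed left charts with general (Tau-valued) background letter, the inverse pair `Zf`∕`Zb`, the reflected data -/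

section MixedCharts

/-- [folklore] THE MIXED LEFT CHART WITH GENERAL (Tau-valued) BACKGROUND LETTER: forward transporter `Z·(1 + σb) = (Z, Z b)`. -/
def GmL (Z b : Form1 d (Tau 𝔸)) : Form1 d (Rho 𝔸) := fun κ x => dmk (Z κ x) 0 * dmk 1 (b κ x)

/-- [folklore] … backward transporter `(1 − σb)·Z̄ = (Z̄, −b Z̄)`. -/
def GmbL (Zb' b : Form1 d (Tau 𝔸)) : Form1 d (Rho 𝔸) := fun κ x => dmk 1 (-b κ x) * dmk (Zb' κ x) 0

variable {𝕜}

omit [Algebra 𝕜 𝔸] in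
/-- [folklore] Components of `GmL`. -/
@[simp] theorem fst_GmL (Z b : Form1 d (Tau 𝔸)) (κ : Fin d) (x : Fin d → ℤ) : (GmL Z b κ x).fst = Z κ x := by
  simp [GmL, fst_dmk]

omit [Algebra 𝕜 𝔸] in
/-- [folklore] Components of `GmL`. -/
@[simp] theorem snd_GmL (Z b : Form1 d (Tau 𝔸)) (κ : Fin d) (x : Fin d → ℤ) : (GmL Z b κ x).snd = Z κ x * b κ x := by
  simp [GmL, fst_dmk, snd_dmk]

omit [Algebra 𝕜 𝔸] in
/-- [folklore] Components of `GmbL`. -/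
@[simp] theorem fst_GmbL (Zb' b : Form1 d (Tau 𝔸)) (κ : Fin d) (x : Fin d → ℤ) : (GmbL Zb' b κ x).fst = Zb' κ x := by
  simp [GmbL, fst_dmk]

omit [Algebra 𝕜 𝔸] in
/-- [folklore] Components of `GmbL`. -/
@[simp] theorem snd_GmbL (Zb' b : Form1 d (Tau 𝔸)) (κ : Fin d) (x : Fin d → ℤ) : (GmbL Zb' b κ x).snd = -(b κ x * Zb' κ x) := by
  simp [GmbL, fst_dmk, snd_dmk]

/-- [folklore] Node 12b's mixed chart IS the mixed left chart at `(Zf W V, upF B)`. -/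
theorem Gm_eq_GmL (W V B : Form1 d 𝔸) : Gm 𝕜 W V B = GmL (Zf 𝕜 W V) (upF B) := by
  funext κ x
  refine TrivSqZeroExt.ext ?_ ?_
  · rw [fst_GmL]; rfl
  · rw [snd_GmL]; rfl

/-- [folklore] … and its backward transporter is the mixed left backward chart at `(Zb W V, upF B)`. -/
theorem Gmb_eq_GmbL (W V B : Form1 d 𝔸) : Gmb 𝕜 W V B = GmbL (Zb 𝕜 W V) (upF B) := by
  funext κ x
  refine TrivSqZeroExt.ext ?_ ?_
  · rw [fst_GmbL]; rfl
  · rw [snd_GmbL]; rfl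

variable (𝕜)

/-- [folklore] The rooted averaging on the mixed left chart. -/
noncomputable def PhiMLAt (ρ : Fin d → ℤ) (Z Zb' b : Form1 d (Tau 𝔸)) (L : ℕ) (μ : Fin d) (y : Fin d → ℤ) : Rho 𝔸 :=
  PhiGAt 𝕜 ρ (GmL Z b) (GmbL Zb' b) L μ y

/-- [folklore] The `Tau`-valued `σ`-JET on the mixed left chart, right-trivialised by the reference averaging `(Z, Z̄) := (Z₀, Z̄₀)`:
the `σ`-component of `logT (Φ(Z, Z̄, b) · invT Φ(Z₀, Z̄₀, b))`. -/
noncomputable def MσLAt (ρ : Fin d → ℤ) (Z Zb' Z₀ Zb₀ b : Form1 d (Tau 𝔸)) (L : ℕ) (μ : Fin d) (y : Fin d → ℤ) : Tau 𝔸 :=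
  (logT 𝕜 (PhiMLAt 𝕜 ρ Z Zb' b L μ y * invT (PhiMLAt 𝕜 ρ Z₀ Zb₀ b L μ y))).snd

/-- [folklore] The rooted MIXED JET on the mixed left chart: the `τ₁τ₂σ`-coefficient, `MjetLAt = c11 (MσLAt …)` (by `rfl`). -/
noncomputable def MjetLAt (ρ : Fin d → ℤ) (Z Zb' Z₀ Zb₀ b : Form1 d (Tau 𝔸)) (L : ℕ) (μ : Fin d) (y : Fin d → ℤ) : 𝔸 :=
  c11 (MσLAt 𝕜 ρ Z Zb' Z₀ Zb₀ b L μ y)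

variable {𝕜}

/-- [folklore] BRIDGE `PhiMAt = PhiMLAt` at `(Zf W V, Zb W V, upF B)`. -/
theorem PhiMAt_eq_PhiMLAt (ρ : Fin d → ℤ) (W V B : Form1 d 𝔸) (L : ℕ) (μ : Fin d) (y : Fin d → ℤ) :
    PhiMAt 𝕜 ρ W V B L μ y = PhiMLAt 𝕜 ρ (Zf 𝕜 W V) (Zb 𝕜 W V) (upF B) L μ y := by
  rw [PhiMAt, PhiMLAt, Gm_eq_GmL, Gmb_eq_GmbL]

/-- [folklore] `MjetLAt = c11 ∘ MσLAt` (by `rfl`). -/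
theorem MjetLAt_eq_c11 (ρ : Fin d → ℤ) (Z Zb' Z₀ Zb₀ b : Form1 d (Tau 𝔸)) (L : ℕ) (μ : Fin d) (y : Fin d → ℤ) :
    MjetLAt 𝕜 ρ Z Zb' Z₀ Zb₀ b L μ y = c11 (MσLAt 𝕜 ρ Z Zb' Z₀ Zb₀ b L μ y) := rfl

/-- [folklore] BRIDGE `MjetAt = MjetLAt` at `(Zf W V, Zb W V; Zf 0 0, Zb 0 0; upF B)`. -/
theorem MjetAt_eq_MjetLAt (ρ : Fin d → ℤ) (W V B : Form1 d 𝔸) (L : ℕ) (μ : Fin d) (y : Fin d → ℤ) :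
    MjetAt 𝕜 ρ W V B L μ y = MjetLAt 𝕜 ρ (Zf 𝕜 W V) (Zb 𝕜 W V) (Zf 𝕜 0 0) (Zb 𝕜 0 0) (upF B) L μ y := by
  rw [MjetAt, MjetLAt, MσLAt, PhiMAt_eq_PhiMLAt, PhiMAt_eq_PhiMLAt]

open Classical in
/-- [folklore] THE REFLECTED BACKGROUND LETTER OF THE MIXED CHART `B♯`: the plain pull-back `ι (B κ (bref α κ x))` off the axis; ON the
axis the sign-flipped letter Ad-rotated by the fluctuation exponential at the partner bond, `−(Zf·ιB·Zb)(α, bref α α x)` (Tau-valued). -/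
noncomputable def BR (α : Fin d) (W V B : Form1 d 𝔸) : Form1 d (Tau 𝔸) := fun κ x =>
  if κ = α then -(Zf 𝕜 W V κ (bref α κ x) * ι (B κ (bref α κ x)) * Zb 𝕜 W V κ (bref α κ x)) else ι (B κ (bref α κ x))

/-- [folklore] `B♯` off the axis. -/
theorem BR_of_ne {α κ : Fin d} (h : κ ≠ α) (W V B : Form1 d 𝔸) (x : Fin d → ℤ) :
    BR (𝕜 := 𝕜) α W V B κ x = ι (B κ (bref α κ x)) := by
  classical
  simp [BR, h]

/-- [folklore] `B♯` on the axis. -/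
theorem BR_self (α : Fin d) (W V B : Form1 d 𝔸) (x : Fin d → ℤ) :
    BR (𝕜 := 𝕜) α W V B α x
      = -(Zf 𝕜 W V α (bref α α x) * ι (B α (bref α α x)) * Zb 𝕜 W V α (bref α α x)) := by
  classical
  simp [BR]

/-- [folklore] `Zf · Zb = 1` (characteristic `≠ 2`: the `τ₁τ₂`-component is `(2⁻¹ + 2⁻¹ − 1)·(WV + VW)`). -/
theorem Zf_mul_Zb (h2 : (2 : 𝕜) ≠ 0) (W V : Form1 d 𝔸) (κ : Fin d) (x : Fin d → ℤ) :
    Zf 𝕜 W V κ x * Zb 𝕜 W V κ x = 1 := by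
  have h22 : (2 : 𝕜)⁻¹ • (W κ x * V κ x + V κ x * W κ x) + (2 : 𝕜)⁻¹ • (W κ x * V κ x + V κ x * W κ x)
      = W κ x * V κ x + V κ x * W κ x := by
    rw [← add_smul, ← two_mul, mul_inv_cancel₀ h2, one_smul]
  refine ext4 ?_ ?_ ?_ ?_
  · simp [Zf, Zb]
  · simp [Zf, Zb]
  · simp [Zf, Zb]
  · simp only [Zf, Zb, c11_mul, c00_mk, c10_mk, c01_mk, c11_mk, one_mul, mul_one, mul_neg, c11_one]
    calc _ = ((2 : 𝕜)⁻¹ • (W κ x * V κ x + V κ x * W κ x) + (2 : 𝕜)⁻¹ • (W κ x * V κ x + V κ x * W κ x))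
          - (W κ x * V κ x + V κ x * W κ x) := by abel
      _ = 0 := by rw [h22, sub_self]

/-- [folklore] `Zb · Zf = 1` (characteristic `≠ 2`). -/
theorem Zb_mul_Zf (h2 : (2 : 𝕜) ≠ 0) (W V : Form1 d 𝔸) (κ : Fin d) (x : Fin d → ℤ) :
    Zb 𝕜 W V κ x * Zf 𝕜 W V κ x = 1 := by
  have h22 : (2 : 𝕜)⁻¹ • (W κ x * V κ x + V κ x * W κ x) + (2 : 𝕜)⁻¹ • (W κ x * V κ x + V κ x * W κ x)
      = W κ x * V κ x + V κ x * W κ x := by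
    rw [← add_smul, ← two_mul, mul_inv_cancel₀ h2, one_smul]
  refine ext4 ?_ ?_ ?_ ?_
  · simp [Zf, Zb]
  · simp [Zf, Zb]
  · simp [Zf, Zb]
  · simp only [Zf, Zb, c11_mul, c00_mk, c10_mk, c01_mk, c11_mk, one_mul, mul_one, neg_mul, c11_one]
    calc _ = ((2 : 𝕜)⁻¹ • (W κ x * V κ x + V κ x * W κ x) + (2 : 𝕜)⁻¹ • (W κ x * V κ x + V κ x * W κ x))
          - (W κ x * V κ x + V κ x * W κ x) := by abel
      _ = 0 := by rw [h22, sub_self]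

/-- [folklore] **THE REFLECTED TRANSPORTER PAIR OF THE MIXED CHART IS A MIXED LEFT-CHART PAIR** (characteristic `≠ 2`): forward direction —
`reflPair α (Gm W V B) (Gmb W V B) = GmL Z♯ B♯` with `Z♯ = reflPair α (Zf W V) (Zb W V)`. -/
theorem reflPair_Gm_Gmb (h2 : (2 : 𝕜) ≠ 0) (α : Fin d) (W V B : Form1 d 𝔸) :
    reflPair α (Gm 𝕜 W V B) (Gmb 𝕜 W V B) = GmL (reflPair α (Zf 𝕜 W V) (Zb 𝕜 W V)) (BR (𝕜 := 𝕜) α W V B) := by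
  classical
  funext κ x
  by_cases h : κ = α
  · subst h
    rw [reflPair_self]
    refine TrivSqZeroExt.ext ?_ ?_
    · rw [fst_GmL, reflPair_self]; rfl
    · rw [snd_GmL, reflPair_self, BR_self]
      show -(ι (B κ (bref κ κ x)) * Zb 𝕜 W V κ (bref κ κ x)) = _
      simp only [mul_neg, ← mul_assoc, Zb_mul_Zf h2, one_mul]
  · rw [reflPair_of_ne h]
    refine TrivSqZeroExt.ext ?_ ?_
    · rw [fst_GmL, reflPair_of_ne h]; rfl
    · rw [snd_GmL, reflPair_of_ne h, BR_of_ne h, bref_of_ne h]; rfl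

/-- [folklore] … backward direction — `reflPair α (Gmb W V B) (Gm W V B) = GmbL Z̄♯ B♯` with `Z̄♯ = reflPair α (Zb W V) (Zf W V)`. -/
theorem reflPair_Gmb_Gm (h2 : (2 : 𝕜) ≠ 0) (α : Fin d) (W V B : Form1 d 𝔸) :
    reflPair α (Gmb 𝕜 W V B) (Gm 𝕜 W V B) = GmbL (reflPair α (Zb 𝕜 W V) (Zf 𝕜 W V)) (BR (𝕜 := 𝕜) α W V B) := by
  classical
  funext κ x
  by_cases h : κ = α
  · subst h
    rw [reflPair_self]
    refine TrivSqZeroExt.ext ?_ ?_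
    · rw [fst_GmbL, reflPair_self]; rfl
    · rw [snd_GmbL, reflPair_self, BR_self]
      show Zf 𝕜 W V κ (bref κ κ x) * ι (B κ (bref κ κ x)) = _
      simp only [neg_mul, neg_neg, mul_assoc, Zb_mul_Zf h2, mul_one]
  · rw [reflPair_of_ne h]
    refine TrivSqZeroExt.ext ?_ ?_
    · rw [fst_GmbL, reflPair_of_ne h]; rfl
    · rw [snd_GmbL, reflPair_of_ne h, BR_of_ne h, bref_of_ne h]; rfl

end MixedCharts

/-! ## §2 The transverse law of the mixed chart (`μ ≠ α`) -/

section MixedTransverse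

variable {𝕜} {L : ℕ} (hL : Odd L)
include hL

/-- [folklore] **`μ ≠ α`, MIXED CHART: THE ROOTED AVERAGING AT THE REFLECTED COARSE BOND IS THE MIXED LEFT-CHART AVERAGING OF THE
REFLECTED DATA** (characteristic `≠ 2`). -/
theorem PhiMAt_sref_of_ne (h2 : (2 : 𝕜) ≠ 0) {α μ : Fin d} (h : μ ≠ α) (W V B : Form1 d 𝔸) (y : Fin d → ℤ) :
    PhiMAt 𝕜 (ctr d L) W V B L μ (sref α y)
      = PhiMLAt 𝕜 (ctr d L) (reflPair α (Zf 𝕜 W V) (Zb 𝕜 W V)) (reflPair α (Zb 𝕜 W V) (Zf 𝕜 W V))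
          (BR (𝕜 := 𝕜) α W V B) L μ y := by
  rw [PhiMAt, PhiGAt_sref_of_ne 𝕜 hL h, reflPair_Gm_Gmb h2, reflPair_Gmb_Gm h2, PhiMLAt]

end MixedTransverse

/-! ## §3 The longitudinal law of the mixed chart (`μ = α`): the reflected averaging is the INVERSE (an3's 33C `RootedAveragingInversion`) -/

section MixedAxis

variable {𝕜}

/-- [folklore] `U_f · U_f⁻¹ = 1` for the mixed chart (characteristic `≠ 2`). -/
theorem Gm_mul_Gmb (h2 : (2 : 𝕜) ≠ 0) (W V B : Form1 d 𝔸) (κ : Fin d) (x : Fin d → ℤ) :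
    Gm 𝕜 W V B κ x * Gmb 𝕜 W V B κ x = 1 := by
  refine TrivSqZeroExt.ext ?_ ?_
  · simp only [dfst_mul, Gm, Gmb, fst_dmk, TrivSqZeroExt.fst_one, Zf_mul_Zb h2]
  · simp only [dsnd_mul, Gm, Gmb, fst_dmk, snd_dmk, TrivSqZeroExt.snd_one, mul_neg, mul_assoc]
    exact neg_add_cancel (Zf 𝕜 W V κ x * (ι (B κ x) * Zb 𝕜 W V κ x))

/-- [folklore] `U_f⁻¹ · U_f = 1` for the mixed chart (characteristic `≠ 2`). -/
theorem Gmb_mul_Gm (h2 : (2 : 𝕜) ≠ 0) (W V B : Form1 d 𝔸) (κ : Fin d) (x : Fin d → ℤ) :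
    Gmb 𝕜 W V B κ x * Gm 𝕜 W V B κ x = 1 := by
  refine TrivSqZeroExt.ext ?_ ?_
  · simp only [dfst_mul, Gm, Gmb, fst_dmk, TrivSqZeroExt.fst_one, Zb_mul_Zf h2]
  · simp only [dsnd_mul, Gm, Gmb, fst_dmk, snd_dmk, TrivSqZeroExt.snd_one, neg_mul, ← mul_assoc, Zb_mul_Zf h2, one_mul]
    rw [mul_assoc, Zb_mul_Zf h2, mul_one, add_neg_cancel]

/-- [folklore] The mixed chart is `≡ 1` modulo the augmentation ideal of `Rho 𝔸`. -/
theorem augR_Gm (W V B : Form1 d 𝔸) (κ : Fin d) (x : Fin d → ℤ) : augR 𝕜 (Gm 𝕜 W V B κ x) = 1 := by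
  simp [augR_apply, Gm, Zf]

/-- [folklore] … and so is its backward transporter. -/
theorem augR_Gmb (W V B : Form1 d 𝔸) (κ : Fin d) (x : Fin d → ℤ) : augR 𝕜 (Gmb 𝕜 W V B κ x) = 1 := by
  simp [augR_apply, Gmb, Zb]

/-- [folklore] **`μ = α`, MIXED CHART: THE MIXED LEFT-CHART AVERAGING OF THE REFLECTED DATA AT `(α, y)` IS THE INVERSE OF THE ROOTED MIXED
AVERAGING AT THE PARTNER BOND `(α, bref α α y)`** (an3-g33's 33C `PhiGAt_reflPair_self_eq_invT` at node 12's instance `Rho 𝔸`, `augR`,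
`nil4_augR`; `L` odd, characteristic `≠ 2`). -/
theorem PhiMLAt_reflPair_self_eq_invT {L : ℕ} (hL : Odd L) (h2 : (2 : 𝕜) ≠ 0) (α : Fin d) (W V B : Form1 d 𝔸) (y : Fin d → ℤ) :
    PhiMLAt 𝕜 (ctr d L) (reflPair α (Zf 𝕜 W V) (Zb 𝕜 W V)) (reflPair α (Zb 𝕜 W V) (Zf 𝕜 W V)) (BR (𝕜 := 𝕜) α W V B) L α y
      = invT (PhiMAt 𝕜 (ctr d L) W V B L α (bref α α y)) := by
  rw [PhiMLAt, ← reflPair_Gm_Gmb h2, ← reflPair_Gmb_Gm h2, PhiMAt]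
  exact PhiGAt_reflPair_self_eq_invT (nil4_augR (𝕜 := 𝕜)) h2 hL (augR_Gm W V B) (augR_Gmb W V B)
    (Gm_mul_Gmb h2 W V B) (Gmb_mul_Gm h2 W V B) α y

/-- [folklore] `μ = α`, MIXED CHART, product form: `Φ^L_{(α,y)}(Z♯, Z̄♯, B♯) · Φ^M_{(α, bref α α y)}(W, V, B) = 1`. -/
theorem PhiMLAt_reflPair_self_mul {L : ℕ} (hL : Odd L) (h2 : (2 : 𝕜) ≠ 0) (α : Fin d) (W V B : Form1 d 𝔸) (y : Fin d → ℤ) :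
    PhiMLAt 𝕜 (ctr d L) (reflPair α (Zf 𝕜 W V) (Zb 𝕜 W V)) (reflPair α (Zb 𝕜 W V) (Zf 𝕜 W V)) (BR (𝕜 := 𝕜) α W V B) L α y
        * PhiMAt 𝕜 (ctr d L) W V B L α (bref α α y) = 1 := by
  rw [PhiMLAt, ← reflPair_Gm_Gmb h2, ← reflPair_Gmb_Gm h2, PhiMAt]
  exact PhiGAt_reflPair_self_mul (nil4_augR (𝕜 := 𝕜)) h2 hL (augR_Gm W V B) (augR_Gmb W V B)
    (Gm_mul_Gmb h2 W V B) (Gmb_mul_Gm h2 W V B) α y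

end MixedAxis

/-! ## §4 The reflected mixed data IN LETTERS: `Z♯ = Zf (R1g α W) (R1g α V)`, `B♯` off∕on the axis, and the axis conjugation `Zb·ιb·Zf` -/

section MixedLetters

variable {𝕜}

/-- [folklore] The backward fluctuation exponential is the forward one of the negated letters: `Zb W V = Zf (−W) (−V)`. -/
theorem Zb_eq_Zf_neg (W V : Form1 d 𝔸) : Zb 𝕜 W V = Zf 𝕜 (-W) (-V) := by
  funext κ x
  simp [Zf, Zb]

/-- [folklore] **THE FLUCTUATION EXPONENTIAL REFLECTS AS THE EXPONENTIAL OF THE SIGNED PULL-BACKS** (an1's `R1g`):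
`reflPair α (Zf W V) (Zb W V) = Zf (R1g α W) (R1g α V)`. -/
theorem reflPair_Zf_Zb (α : Fin d) (W V : Form1 d 𝔸) :
    reflPair α (Zf 𝕜 W V) (Zb 𝕜 W V) = Zf 𝕜 (R1g α W) (R1g α V) := by
  funext κ x
  by_cases h : κ = α
  · subst h; simp [reflPair, R1g, Zf, Zb]
  · simp [reflPair, R1g, h, Zf]

/-- [folklore] … and `reflPair α (Zb W V) (Zf W V) = Zb (R1g α W) (R1g α V)`. -/
theorem reflPair_Zb_Zf (α : Fin d) (W V : Form1 d 𝔸) :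
    reflPair α (Zb 𝕜 W V) (Zf 𝕜 W V) = Zb 𝕜 (R1g α W) (R1g α V) := by
  funext κ x
  by_cases h : κ = α
  · subst h; simp [reflPair, R1g, Zf, Zb]
  · simp [reflPair, R1g, h, Zb]

/-- [folklore] `B♯` off the axis is the embedded signed pull-back: `B♯ κ x = ι (R1g α B κ x)` (`κ ≠ α`). -/
theorem BR_of_ne_R1g {α κ : Fin d} (h : κ ≠ α) (W V B : Form1 d 𝔸) (x : Fin d → ℤ) :
    BR (𝕜 := 𝕜) α W V B κ x = ι (R1g α B κ x) := by
  classical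
  simp [BR, R1g, h]

/-- [folklore] **`B♯` ON THE AXIS = the signed pull-back Ad-rotated by the INVERSE exponential of the reflected letters**:
`B♯ α x = Zb (R1g α W) (R1g α V) α x · ι (R1g α B α x) · Zf (R1g α W) (R1g α V) α x`. -/
theorem BR_self_R1g (α : Fin d) (W V B : Form1 d 𝔸) (x : Fin d → ℤ) :
    BR (𝕜 := 𝕜) α W V B α x
      = Zb 𝕜 (R1g α W) (R1g α V) α x * ι (R1g α B α x) * Zf 𝕜 (R1g α W) (R1g α V) α x := by
  have hι : ∀ a : 𝔸, (ι (-a) : Tau 𝔸) = -ι a := fun a => ext4 (by simp) (by simp) (by simp) (by simp)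
  rw [BR_self, ← reflPair_Zb_Zf, ← reflPair_Zf_Zb, reflPair_self, reflPair_self]
  simp only [R1g, if_true, hι, mul_neg, neg_mul]

/-- [folklore] **THE AXIS CONJUGATION IN COMPONENTS** (exact, `τ₁² = τ₂² = 0`): for letters `w v b : 𝔸`,
`Zb w v · ιb · Zf w v = (b, bw − wb, bv − vb, ½(wv+vw)b + b·½(wv+vw) − wbv − vbw)` in `Tau 𝔸 = (c00, c10, c01, c11)`. -/
theorem Zb_mul_ι_mul_Zf (W V : Form1 d 𝔸) (b : 𝔸) (κ : Fin d) (x : Fin d → ℤ) :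
    Zb 𝕜 W V κ x * ι b * Zf 𝕜 W V κ x
      = Tau.mk b (b * W κ x - W κ x * b) (b * V κ x - V κ x * b)
          ((2 : 𝕜)⁻¹ • (W κ x * V κ x + V κ x * W κ x) * b + b * ((2 : 𝕜)⁻¹ • (W κ x * V κ x + V κ x * W κ x))
            - W κ x * b * V κ x - V κ x * b * W κ x) := by
  refine ext4 ?_ ?_ ?_ ?_
  · simp [Zf, Zb]
  · simp [Zf, Zb]; abel
  · simp [Zf, Zb]; abel
  · simp [Zf, Zb, mul_add, add_mul]; abel

end MixedLetters

end Summit.QuantumFields.BalabanUV.Beta.RootedMixedChartReflection
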